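import Mathlib
import HarnessLib
import HarnessLib.Audit
import Summits.AtomisticToContinuum.Statement
import Summits.AtomisticToContinuum.BoseEinsteinCondensation.Theorems.BECInfraredBoundAssembly
import Summits.AtomisticToContinuum.BoseEinsteinCondensation.Theorems.BECCutLineWeakDisorderOccupationStability
import HarnessLib.Audit.Status.Attr

/-!
Route: BECClassicalWindow

DORMANT since 2026-08-25T09:06:23Z (reconciler: no traction for 7.6 d (last activity item-evidence-added at 2026-08-17T19:09:23Z); parked, not closed — `ledger route dormant route-AtomisticToContinuum-BECClassicalWindow --off` to reacti) — unstaffed, not closed; items shared with open routes are served there. `ledger route dormant <id> --off` reactivates.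

# Route BECClassicalWindow — Heat it to cool it — prove constant-mode BEC first at T = θρ^(2/3),
where the infrared beyond ξ is a weakly coupled CLASSICAL φ⁴₃, then descend to T = 0 by thermal
monotonicity

It suffices to show X = ThermalWindowZeroMode ∧ ThermalMonotonicity ∧ ThermalGroundStateLimit (card
thermal-window-classical-infrared;
its P4 is card heating-only-depletes-thermal-bridge's M_T, credited). D-0027 §2.1-conforming
re-opening of the retired
route-AtomisticToContinuum-BECThermalWindow (same items; the deciding theorem `closes` is PROVED in
glue.lean and concludes the audited
sub-problem abbrev _root_.BoseEinsteinCondensation by name, via the glue support ThermalDescent and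
AtomisticToContinuum.BECInfraredBound.bec_of_zeroMode). Thermal states are typed WITHOUT operators,
exactly as the conjunct
types the ground state: a finite ENSEMBLE (m, p, Ψ) — weights pᵢ ≥ 0, Σpᵢ = 1, on pairwise
L²-orthogonal Dirichlet trial states
Ψᵢ ∈ TrialState N L — is the density matrix Γ = Σ pᵢ|Ψᵢ⟩⟨Ψᵢ|, with Tr HΓ = Σ pᵢ·energy Ψᵢ, entropy
S(Γ) = Σ negMulLog pᵢ and
Tr Γn(φ₀) = Σ pᵢ·occupation φ₀ Ψᵢ (φ₀ = L^{-3/2}1_box); "δ-near-minimiser of the free energy F_T = U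
− T·S" is written in ℝ≥0∞ against
every competitor ensemble E′ as U(E) + T·S(E′) ≤ U(E′) + T·S(E) + δ. By the Gibbs variational
principle and Pinsker
(F(Γ) − F(Γ_T) = T·S(Γ‖Γ_T) ≥ (T/2)‖Γ − Γ_T‖₁²), "∃δ > 0, every δ-near-minimising ensemble has Σpᵢ
n₀(Ψᵢ) ≥ c" says Tr Γ_T n(φ₀) ≥ c for
the canonical Gibbs state Γ_T (up to strictness). ThermalWindowZeroMode: for every admissible v
there are θ > 0 and ρ₀ > 0 such that for
ρ < ρ₀, at temperature T = θρ^{2/3} (a fixed fraction of the free critical temperature 6.625ρ^{2/3},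
hence T/μ = θ/(8π(ρa³)^{1/3}) → ∞: the
THERMAL WINDOW), the thermal constant-mode occupation in the Dirichlet box of side (N/ρ)^{1/3} is ≥
cN for all large N.
ThermalMonotonicity: at small ρ and large N, cooling never lowers it (T₂ ≤ T₁ ⇒ ⟨n(φ₀)⟩_{T₂} ≥
⟨n(φ₀)⟩_{T₁}). ThermalGroundStateLimit:
at fixed N, L, a bound holding at all T ≤ T₀ is inherited by some near-minimiser of the ENERGY at
every slack.
Lean: `ThermalWindowZeroMode ∧ ThermalMonotonicity ∧ ThermalGroundStateLimit`

## Assembly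
Fix an admissible v. ThermalWindowZeroMode gives θ, ρ₀ and, for ρ < ρ₀ (also below the ρ₀'s of
ThermalMonotonicity and
GroundStateRigidity), c > 0 and eventually in N a slack δ with thermal occupation ≥ cN at T₁ =
θρ^{2/3}. ThermalMonotonicity (eventually
in N) transports the bound to every T₂ ≤ T₁ with constant cN/2, which is the hypothesis of
ThermalGroundStateLimit at (N, L = (N/ρ)^{1/3},
T₀ = T₁, c := cN/2): for every energy slack δ′ some δ′-near-minimiser Ψ has ⟨φ₀,γ_Ψφ₀⟩ ≥ cN/4.
GroundStateRigidity with η = c/16 gives δ_R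
such that any δ_R-near-minimiser Φ is η-close to Ψ (taken at δ′ = δ_R) up to a phase, and
OccupationStability (N = n+1, u = φ₀, measurable
and normalised for L > 0) yields occ(Φ)^{1/2} ≥ (cN/4)^{1/2} − (N·c/16)^{1/2} = (cN)^{1/2}/4, i.e.
⟨φ₀,γ_Φφ₀⟩ ≥ cN/16 for EVERY
δ_R-near-minimiser: this is X_B1 (stmt-AtomisticToContinuum-0686) with constant c/16 — exactly the
support ThermalDescent — and X_B1 →
BoseEinsteinCondensation is the proved theorem AtomisticToContinuum.BECInfraredBound.bec_of_zeroMode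
(occupation_le_maxOccupation +
le_condensateNumber). DECIDING THEOREM (glue.lean, sorry-free, axioms
propext/Classical.choice/Quot.sound, rc 0 on the farm):
`theorem closes : ThermalWindowZeroMode → ThermalMonotonicity → GroundStateRigidity →
ThermalGroundStateLimit → OccupationStability →
ThermalDescent → _root_.BoseEinsteinCondensation := fun h₁ h₂ h₃ h₄ h₅ h₆ =>
_root_.AtomisticToContinuum.BECInfraredBound.bec_of_zeroMode (h₆ h₁ h₂ h₃ h₄ h₅)`.

Rationale: WHY THIS LINE. One scale inequality nobody has used for the thermodynamic-limit problem: with ħ = 2m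
= k_B = 1, μ = 8πρa = ξ⁻², phonons of
wavelength r are classically occupied iff r > L_T = c/T, and L_T < ξ ⟺ T > √2μ, λ_T < ξ ⟺ T > 4πμ,
while μ/T_c⁰ ≍ (ρa³)^{1/3} → 0:
for μ ≪ T ≤ T_c⁰/2 every scale beyond the healing length is Rayleigh–Jeans, the zero-point phase
fluctuations that make T = 0 the
(3+1)-dimensional MARGINAL problem (barrier BogoliubovPerturbationInfrared; Benfatto1994, BFKT2017)
are absent beyond ξ, and what remains
there is the n = 0 Matsubara sector — a POSITIVE, super-renormalisable, weakly coupled (u₀ = 8πa√T ≍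
(ρa³)^{1/3}) two-component
classical φ⁴₃/XY measure deep in its broken phase (stiffness K(ξ) ≍ (ρa³)^{-1/6}), for which
continuous-symmetry breaking is a 1976
theorem (FrohlichSimonSpencer1976 infrared bounds; Balaban1995 low-temperature RG and
GarbanSpencer2022 as RP-free engines) and whose
large-field problem BFKT2017 themselves call routine for Euclidean O(n) actions. This is the
rigorous form of the classical-field
reduction the physicists used to compute ΔT_c (doi:10.1103/PhysRevLett.83.1703,
doi:10.1103/physrevlett.87.120401,
doi:10.1103/physrevlett.87.120402), the fixed-(ρa³, T/T_c) thermodynamic-limit cousin of the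
mean-field classical-field limits
(doi:10.1007/s00222-020-01010-4, doi:10.1090/jams/987) and of the GP-scaling positive-temperature
BEC of doi:10.1007/s00205-020-01489-4;
positive-temperature TL-BEC is itself open (only T_c UPPER bounds: doi:10.1103/physrevb.80.014502) —
but in the window there is a small
parameter, unlike at T = 0. The descent to the ground state is a β-monotonicity
(Griffiths/Ginibre-type) inequality — temperature is the
one deformation whose favourable end IS the physical point of the conjunct — replacing the
Kennedy–Lieb–Shastry T → 0 trick that is
welded to Gaussian domination (KennedyLiebShastry1988). Imported areas: finite-temperature field
theory (Matsubara decomposition,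
dimensional reduction), constructive classical statistical mechanics (IR bounds, N-vector RG),
correlation inequalities. Versus every
existing route (BECInfraredBound, BECPinning, BECRenormGroup, BECPeriodicReduction, BECPalmLandscape
and today's T = 0 routes): the only
line at T > 0; it reuses GroundStateRigidity/OccupationStability of BECPalmLandscape verbatim and
lands on X_B1 (stmt-0686), whose
X_B1 → BoseEinsteinCondensation is PROVED (AtomisticToContinuum.BECInfraredBound.bec_of_zeroMode).
Negatives index: empty.

RANKED CRUXES. #2 ThermalWindowZeroMode (crux) — (card P1–P3, the engine's deliverable) for every
repulsive finite-range v there are θ > 0 and ρ₀ > 0 such that for 0 < ρ < ρ₀ there is c > 0 with: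
for all large N there is δ > 0 such that every finite ensemble (pᵢ, Ψᵢ)_{i<m} of pairwise orthogonal
Dirichlet trial states in the box of side L = (N/ρ)^{1/3} that is a δ-near-minimiser of the free
energy Σpᵢ·energy(Ψᵢ) − T·Σ negMulLog pᵢ at T = θρ^{2/3} has thermal constant-mode occupation
Σpᵢ⟨φ₀,γ_{Ψᵢ}φ₀⟩ ≥ cN (φ₀ = L^{-3/2}1_box). Positive-temperature TL-BEC at one temperature in the
classical window; v ≡ 0: true (canonical ideal gas below T_c⁰, constant-mode share (8/π²)³ of the
ground mode). [difficulty: open-problem] (why it might fail: T>0 TL-BEC is itself open (only T_c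
upper bounds exist); the classical reduction must first resum the two-body ladder (v ↦ 8πa; hard
cores) and integrate out n≠0 Matsubara + hard spatial modes UNIFORMLY in L — no such cluster
expansion is in print (LNR/FKSS are mean-field, DS2020 is GP scaling).)
[doi:10.1103/physrevb.80.014502, doi:10.1007/s00205-020-01489-4, doi:10.1007/s00222-020-01010-4,
doi:10.1090/jams/987, doi:10.1103/physrevlett.87.120401, doi:10.1103/PhysRevLett.83.1703,
FrohlichSimonSpencer1976, Balaban1995, BFKT2017, LSSY2005]
#3 ThermalMonotonicity (crux) — (card P4 = card heating-only-depletes-thermal-bridge's M_T, dilute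
eventual form, Dirichlet box, constant mode) for every repulsive finite-range v there is ρ₀ > 0 such
that for 0 < ρ < ρ₀ and all large N (L = (N/ρ)^{1/3}), for all temperatures 0 < T₂ ≤ T₁ and every c:
if for some δ > 0 every δ-near-minimising ensemble of the free energy at T₁ has thermal
constant-mode occupation ≥ c, then for every c′ < c there is δ′ > 0 such that every
δ′-near-minimising ensemble at T₂ has occupation ≥ c′ — i.e. T ↦ Tr Γ_T n(φ₀) is non-increasing
("heating only depletes"; d⟨n(φ₀)⟩/dβ = −Cov_β(H, n(φ₀)) ≥ 0). Bogoliubov-exact term by term (every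
thermal quasiparticle removes ≥ 1 particle from the condensate); ideal gas: Borrmann–Franke
recursion; interacting: unproved even on the lattice. [difficulty: L] (why it might fail: no
Griffiths/Ginibre/FKG structure signing Cov_β(H, n(φ₀)) is known for interacting bosons (BLU leave
the U(1) combination indefinite); a low excited level more condensed than Ψ₀, or Dirichlet
mode-mixing of the non-eigen constant mode, would give re-entrant stretches.) [Ginibre1970,
arXiv:1510.03215, KennedyLiebShastry1988, LSSY2005, doi:10.1063/1.2383008]
#4 GroundStateRigidity (crux) — (shared verbatim with BECPalmLandscape
stmt-AtomisticToContinuum-3298; the uniqueness input of the descent) for every repulsive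
finite-range v there is ρ₀ > 0 such that for 0 < ρ < ρ₀ and all large N, for every η > 0 there is δ
> 0 with: any two δ-near-minimisers Ψ, Φ of the Dirichlet energy in the box of side (N/ρ)^{1/3}
satisfy ∫|Ψ − cΦ|² ≤ η for some unit complex c (E₀ < ∞, compact resolvent, unique positive ground
state and spectral gap at fixed N). [difficulty: M] (why it might fail: v = ⊤ walls (hard cores,
impenetrable shells ⊤·1_[r₁,r₂]) disconnect configuration space; uniqueness then needs every
non-dilute component (jammed/bound clusters) to lie an N-uniform gap above E₀ — low-density
connectivity of hard-sphere configuration spaces is open in general.) [ReedSimonIV1978,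
doi:10.1093/imrn/rnt012, LSSY2005]
#9 ThermalGroundStateLimit (support) — (card P4's β → ∞ step, fixed N and L > 0) if for some c and
all temperatures 0 < T ≤ T₀ there is δ(T) > 0 such that every δ-near-minimising ensemble of the free
energy at T has thermal constant-mode occupation ≥ c, then for every c′ < c and every energy slack
δ′ > 0 there is a Dirichlet trial state Ψ with energy ≤ E₀(N,L) + δ′ and ⟨φ₀,γ_Ψφ₀⟩ ≥ c′. Proof:
Z(β) = Tr_sym e^{−βH} < ∞ (compact resolvent, Weyl), the finite-ensemble infimum of F is −T log Z
(Gibbs variational principle on the C¹ form core), Pinsker gives Tr Γ_T n(φ₀) ≥ c, Γ_T → Π₀/g in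
trace norm as T → 0, so some ground state has n(φ₀) ≥ c; approximate it in form norm by C¹ Dirichlet
trial states (occupation is L²-continuous). Known analysis, heavy in Lean (no operators yet: the
whole argument must be run on quadratic forms / ensembles). [difficulty: L] [ReedSimonIV1978,
LSSY2005]
#9 OccupationStability (support) — (shared verbatim with BECPalmLandscape
stmt-AtomisticToContinuum-3300) for a normalised measurable mode u, trial states Ψ, Φ ∈ TrialState
(n+1) L and |c| = 1: occ(u,Ψ)^{1/2} ≤ occ(u,Φ)^{1/2} + (n+1)^{1/2}·‖Ψ − cΦ‖₂ (Minkowski in L²(dY);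
occ(cΦ) = occ(Φ)). [difficulty: provable-now] [LSSY2005]
#9 ThermalDescent (support) — (glue, provable now; the analytic bookkeeping of the assembly isolated
as one lemma so that the deciding theorem is one line) ThermalWindowZeroMode → ThermalMonotonicity →
GroundStateRigidity → [ThermalGroundStateLimit, inlined] → [OccupationStability, inlined] → X_B1
(stmt-AtomisticToContinuum-0686 body verbatim: every δ-near-minimiser of the Dirichlet energy has
⟨φ₀,γ_Ψφ₀⟩ ≥ c′N). Proof = the paragraph under ## Assembly (constants c/2, c/4, η = c/16, c′ = c/16;
intersect the eventual-in-N sets; ENNReal.ofReal / rpow ½ arithmetic). [difficulty: provable-now]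
[LSSY2005]

TWO-LAYER PLAN. Foreseen, nothing filed as typed items now. ThermalWindowZeroMode ⇐ EITHER (A,
Gaussian-domination shape) ThermalInfraredBound →
ThermalUltravioletTail → ThermalWindowZeroMode: for near-minimising ensembles at T = θρ^{2/3},
inner-box plane waves φ′_k (k ≠ 0, box
(εL, L−εL)³ as in stmt-0733) obey the Rayleigh–Jeans bound Σpᵢ⟨φ′_k,γφ′_k⟩ ≤ C·T·L²/(2π|k|)² for
(2π|k|/L)² ≤ T (classical equipartition
of the phase mode, n_p ≈ T/2p², μ-independent) and the Bose tail ≤ C·exp(−(2πk/L)²/2T) beyond,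
whence Parseval + Σ_{k≠0} ≤ C′T^{3/2}L³ =
C′N(T/T_c⁰)^{3/2}·const gives the constant mode ≥ cN for θ small — DLS/KLS mode counting at T > 0
transplanted to the continuum, the
classical IR bound being the entire content; OR (B, the card's engine) ClassicalWindowReduction
(informal crux filed at open: block-averaged
field on cells λ_T ≤ ℓ ≤ ξ is e^{−S_cl−R}, S_cl = NN two-component lattice φ⁴₃ with stiffness ≍
(ρa³)^{−1/6}, R quasi-local and small
uniformly in L, obtained after the ladder resummation v ↦ 8πa by integrating out n ≠ 0 Matsubara and
hard spatial modes) →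
PerturbedClassicalLRO (FSS if the blocking is RP and R is RP-stably small; else Balaban1995 /
GarbanSpencer2022) → BosonFieldComparison
(⟨a†_x a_y⟩ ≥ T⟨φ̄_xφ_y⟩ − coarse-graining error) → ThermalWindowZeroMode. ThermalMonotonicity ⇐
KineticCovariance → InteractionCovariance →
ThermalMonotonicity (Cov_β(T_kin, n₀) ≤ 0 and Cov_β(V, n₀) ≤ 0 separately, Ginibre duplication in
the U(1)-symmetric cone), with the ideal
gas (Borrmann–Franke recursion P(n₀ ≥ j) = Z_{N−j}/Z_N) and the hard-core lattice gas as
support-level instances. ThermalGroundStateLimit ⇐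
PartitionFinite → GibbsToGroundSpace → TrialApproximation. k ≤ 3 each, depth 1.

KILL CRITERIA. (i) A proof of ¬ThermalWindowZeroMode (no constant-mode BEC at ANY T = θρ^{2/3} for
some admissible v at arbitrarily small ρ — e.g. because
the n ≠ 0 remainder regenerates a marginal coupling and destroys order uniformly in L) closes the
route: `close --reason
refuted:ThermalWindowZeroMode`. (ii) ¬ThermalMonotonicity in the filed eventual dilute form kills
the descent, not the engine: pivot by
`--restate` to the torus / top-natural-orbital form, or re-open ThermalWindowZeroMode as a
positive-temperature (Literature-variant) route;
small-N exact-diagonalisation non-monotonicity alone does not refute the eventual statement but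
triggers that pivot review. (iii)
¬GroundStateRigidity for some admissible v (degenerate Dirichlet ground states at low density)
breaks the Dirichlet descent of every
X_B1-type route: pivot to the torus chain PeriodicBEC + BoundaryTransferWeak (stmt-0826/0827). (iv)
X_B1 (stmt-0686) proved elsewhere moots
the T = 0 half; ThermalWindowZeroMode remains the open positive-temperature theorem and keeps its
value.

NOT DECOMPOSED YET. How ThermalWindowZeroMode is proved (splits A/B above are layer 2); the
Dyson-lemma softening of hard cores and the two-body ladder
resummation preceding any expansion; the choice of blocking (nearest-neighbour lattice gradient for
reflection positivity vs smooth
cutoff); the coarse-grained-field-vs-a_x bookkeeping (P3); Wick ordering / μ_eff matching in d = 3;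
Z(β) < ∞, Gibbs → ground space and
form-core approximation inside ThermalGroundStateLimit; the ideal-gas and lattice instances of
ThermalMonotonicity; the torus variant of all
three statements (would land on PeriodicBEC, stmt-0826); canonical vs grand-canonical; the value of
θ (any θ below 4π/ζ(3/2)^{2/3} should do;
the statement only asks for one).

CHEAPEST FALSIFIER. (a) Exact diagonalisation of ThermalMonotonicity's finite-size analogue: N = 3–6
bosons, Bose–Hubbard U ∈ {1, 4, ∞} on 2×2×2 and 3×3×2
clusters with open (Dirichlet-like) and periodic boundaries, canonical ⟨n(φ₀)⟩_β on a β-grid; a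
non-monotone stretch that GROWS with N flags
the crux (a shrinking one is the expected finite-size artefact). Not run here (no numerics on the
hub for this unit; recommended as the
refuter's first kit job). (b) v ≡ 0 (admissible): ThermalWindowZeroMode true (canonical ideal gas at
T = θρ^{2/3} < T_c⁰: ground-mode
fraction → 1 − (T/T_c⁰)^{3/2}, constant-mode share (8/π²)³ = 0.5325 of it); ThermalMonotonicity
checked BY HAND in the Boltzmann regime:
d/dβ Σ_k w_k e^{−βε_k}/Σ_k e^{−βε_k} = −Cov(w, ε) ≥ 0 for the constant-mode weights w_k = Π_i
8/(π²k_i²) (odd k_i; 0 else), since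
E[k²] ≥ E[k² | k odd] ≥ 1/E[k⁻² | k odd] per axis — consistent; the Bose-canonical free case is the
Borrmann–Franke exercise. (c) One-loop power
counting of the n ≠ 0 / hard-mode remainder at T = T_c⁰/2 with the ladder-resummed vertex: is R =
O((ρa³)^{1/3}) uniformly in L? (two pages;
a negative answer kills engine B and leaves only shape A).

NUMBERS. Units ħ = 2m = k_B = 1. μ = 8πρa = ξ⁻²; c_sound = √(2μ); T_c⁰ = 4π(ρ/ζ(3/2))^{2/3} =
6.625ρ^{2/3}; λ_T = √(4π/T); λ_T < ξ ⟺ T > 4πμ;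
L_T = c/T < ξ ⟺ T > √2μ; at T = θρ^{2/3}: T/μ = θ/(8π(ρa³)^{1/3}) → ∞ and T/T_c⁰ = θ/6.625 fixed.
Ideal condensate fraction 1 − (T/T_c⁰)^{3/2}
(0.646 at T_c⁰/2). Classical coupling u₀ = 8πa√T ≤ 64.7(ρa³)^{1/3} at T ≤ T_c⁰ (small only
asymptotically: < 1 needs ρa³ < 3.7·10⁻⁶);
stiffness K(ξ) = 2ρ_sξ/T ≍ (ρa³)^{−1/6} at T ≤ T_c⁰/2. ΔT_c/T_c⁰ = c·aρ^{1/3} with c = 1.32 ± 0.02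
(doi:10.1103/physrevlett.87.120401),
1.29 ± 0.05 (doi:10.1103/physrevlett.87.120402); rigorous: no BEC for T > T_c⁰(1 + 5.09√(aρ^{1/3}))
(doi:10.1103/physrevb.80.014502);
positive-T BEC proved only in GP scalings Na/L fixed (doi:10.1007/s00205-020-01489-4,
doi:10.1007/s00220-018-3239-0), where μ/T_c ~ N^{−2/3}.
Free Dirichlet constant-mode share (8/π²)³ = 0.5325 (refuter note on stmt-0733). Items at open: 7 (3
cruxes, 3 supports incl. the glue ThermalDescent, 1 assembly) + the deciding theorem; 1 informal
crux re-filed after open; definition requests defn-ThermalExpectation / defn-LatticePhi4Gibbs and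
cite request wi-16908 already exist from the retired predecessor.

DEFINITION REQUESTS. After open: (1) informal crux `ClassicalWindowReduction` (rank 5, child of
ThermalWindowZeroMode, engine B) by `ledger workitem add
--informal`; (2) definition `ThermalExpectation` (topic
Literature/MathematicalPhysics/QuantumManyBody): the canonical Gibbs expectation
⟨A⟩_{β,N,L} of a bounded one-body observable for the Dirichlet / periodic N-boson Hamiltonian — as
Tr(e^{−βH}A)/Tr e^{−βH} once trace-class
semigroups exist, meanwhile as the sup-inf over free-energy near-minimising finite ensembles used
verbatim in this route (so the three
thermal items can be restated in one line each); (3) definition `LatticePhi4Gibbs` (topic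
Literature/Probability/LatticeModels or
MathematicalPhysics/StatisticalMechanics): the two-component classical φ⁴/XY Gibbs probability
measure on ((Fin n)³ → ℂ) with density ∝
exp(−K Σ_{x,k}|φ(x+e_k) − φ(x)|² − K′Σ_x(|φ_x|² − 1)²) w.r.t. Lebesgue — Mathlib-statable today
(finite-dimensional integral); (4) cite
request: FSS 1976 long-range order for RP nearest-neighbour N-component lattice models in d ≥ 3 at
large stiffness (FrohlichSimonSpencer1976 =
doi:10.1007/bf01608557, Thm. 3.1/§4; FrohlichIsraelLiebSimon1978) as a named Literature fact over
LatticePhi4Gibbs. The typed items need no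
new notion (TrialState, energy, groundStateEnergy, occupation, box, sideLength,
IsRepulsiveFiniteRange, Real.negMulLog, starRingEnd exist).

Novelty: Searches (2026-08-15, this seat; OpenAlex/arXiv/S2 HTTP 429 all hour, searchd FTS tier down, galaxy
saturated ×2): `lit search --hybrid
"classical field approximation Bose gas positive temperature condensate thermodynamic limit"` (12
textbook hits: LSSY2005 pp. 170–177,
Pethick–Smith, Griffin1993 — nothing rigorous in the TL); `lit search --source zbmath "classical
field theory limit Bose gas Gibbs measure
many-body"` (4: doi:10.1007/s00222-020-01010-4, doi:10.1090/jams/987, arXiv:2512.10704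
Jougla–Rougerie 2026 (Φ⁴₂ limit of a bosonic FREE
ENERGY, d = 2, mean-field-type scaling), Rota Nodari Bourbaki 2025); `--source zbmath/crossref
"Bose-Einstein condensation positive temperature
dilute Bose gas thermodynamic limit"` (doi:10.1007/s00220-018-3239-0, doi:10.1007/s00205-020-01489-4
only); `--source crossref "critical
temperature shift dilute Bose gas classical field lattice"` (doi:10.1103/physrevlett.87.120402,
doi:10.1103/physreva.81.023611,
doi:10.1209/0295-5075/121/10007); `--source crossref "upper bound critical temperature Bose gas
Seiringer Ueltschi"`
(doi:10.1103/physrevb.80.014502, doi:10.1007/s00220-008-0428-2, 2-D free-energy papers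
doi:10.1017/fms.2020.17, doi:10.1063/5.0005950);
`--source zbmath "free energy dilute Bose gas Lee-Huang-Yang temperature"` (arXiv:2405.03378, Adv.
Math. 2026: T ≲ ρa, BELOW the window);
`--source zbmath "low temperature expansion classical N-vector models renormalization group
Balaban"` (Balaban1995 I–III); `--source zbmath
"infrared bou  [refs: 10.1007/s00222-020-01010-4, 10.1090/jams/987, 10.1007/s00220-018-3239-0, 10.1007/s00205-020-01489-4, 10.1103/physrevlett.87.120402, 10.1103/physreva.81.023611, 10.1209/0295-5075/121/10007, 10.1103/physrevb.80.014502, 10.1007/s00220-008-0428-2, 10.1017/fms.2020.17, 10.1063/5.0005950, 10.1103/physrevlett.87.120401, 10.1103/PhysRevLett.83.1703, 2512.10704, 2405.03378, 2603.20776, 2510.20493, 2602.165]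

Barriers (technique_class: dimensional-reduction classical-field thermal-window): - technique_class: dimensional-reduction classical-field thermal-window
- Literature.Barriers.AtomisticToContinuum.BogoliubovPerturbationInfrared: evaded inside the window
— for T ≫ μ the scales beyond ξ carry only the n = 0 Matsubara sector, a POSITIVE classical Gibbs
measure in d = 3 (super-renormalisable UV; Goldstone infrared handled non-perturbatively by IR
bounds / Balaban's RG, whose large-field problem BFKT2017 call routine for Euclidean O(n) actions),
while the quantum sector lives at scales < λ_T < ξ where modes are massive/parabolic; nothing is
expanded to finite order around Bogoliubov at T = 0 (the barrier's typed object is the (3+1)-D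
bubble; here the frequency direction is summed exactly). Conceded: the ladder resummation and the
uniform-in-L integration of n ≠ 0 modes are the open step (why-might-fail of ThermalWindowZeroMode).
- Literature.Barriers.AtomisticToContinuum.BogoliubovPerturbationInfraredNarrow: same — no
finite-order particle-representation expansion of a non-gauge-invariant propagator below the
Ginzburg scale; the bounded object ⟨φ₀,γφ₀⟩ is gauge-invariant.
- Literature.Barriers.AtomisticToContinuum.KineticGapLengthScales: evaded — no L⁻² gap converts
energy to depletion at scale L (L → ∞ at fixed ρ and T); the fixed-N gap enters only
ThermalGroundStateLimit / GroundStateRigidity, with δ, β⁻¹ → 0 AFTER N is fixed — the exit named in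
the audit of KineticGapLengthScalesNarrow.
- Literature.Barriers.AtomisticToContinuum.KineticGapLengthScalesNarrow:

History (route lifecycle, newest last):
- 2026-08-25T09:06:23Z · DORMANT — reconciler: no traction for 7.6 d (last activity item-evidence-added at 2026-08-17T19:09:23Z); parked, not closed — `ledger route dormant route-AtomisticToConti (operator:999:3604304)

sub-problem: BoseEinsteinCondensation · status: dormant · opened planner-plancard-AtomisticToContinuum-BoseEin-3c98a4b7-0 2026-08-15T13:47:58Z · rev 2 · ledger route-AtomisticToContinuum-BECClassicalWindow
GENERATED by the gate from the ledger (D-0016/17). Provers cite these decls: `theorem foo : Summit.AtomisticToContinuum.BoseEinsteinCondensation.Theses.BECClassicalWindow.<Decl> := …` in Summits/AtomisticToContinuum/BoseEinsteinCondensation/Theorems/<Name>.lean.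
-/

namespace Summit.AtomisticToContinuum.BoseEinsteinCondensation.Theses.BECClassicalWindow

open scoped BigOperators Topology Manifold Classical MeasureTheory ProbabilityTheory Matrix InnerProductSpace ComplexConjugate ContinuousMap
open Filter Set Function TopologicalSpace MeasureTheory

attribute [summit_statement] _root_.BoseEinsteinCondensation

/-- item stmt-AtomisticToContinuum-9070 · crux · rank 2 · open · by planner
why it might fail: T>0 BEC in the thermodynamic limit is open at every T < T_c (rigorous: a T_c upper bound; BEC only in GP scalings); the classical reduction needs the ladder resummation v -> 8 pi a (hard cores) and integrating out n != 0 Matsubara + hard modes with remainder small UNIFORMLY in L: not in print.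
sources: SeiringerUeltschi2009, DeuchertSeiringer2020, doi:10.1007/s00222-020-01010-4, doi:10.1090/jams/987, doi:10.1103/physrevlett.87.120401, doi:10.1103/PhysRevLett.83.1703
[crux] (card P1–P3, the engine's deliverable) for every repulsive finite-range v there are θ > 0 and
ρ₀ > 0 such that for 0 < ρ < ρ₀ there is c > 0 with: for all large N there is δ > 0 such that every
finite ensemble (pᵢ, Ψᵢ)_{i<m} of pairwise orthogonal Dirichlet trial states in the box of side L =
(N/ρ)^{1/3} that is a δ-near-minimiser of the free energy Σpᵢ·energy(Ψᵢ) − T·Σ negMulLog pᵢ at T =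
θρ^{2/3} has thermal constant-mode occupation Σpᵢ⟨φ₀,γ_{Ψᵢ}φ₀⟩ ≥ cN (φ₀ = L^{-3/2}1_box).
Positive-temperature TL-BEC at one temperature in the classical window; v ≡ 0: true (canonical ideal
gas below T_c⁰, constant-mode share (8/π²)³ of the ground mode). [difficulty: open-problem] -/
@[route_item "route-AtomisticToContinuum-BECClassicalWindow", crux]
def ThermalWindowZeroMode : Prop :=
  ∀ v : ℝ → ENNReal, Literature.MathematicalPhysics.QuantumManyBody.BoseGas.IsRepulsiveFiniteRange v → ∃ θ : ℝ, 0 < θ ∧ ∃ ρ₀ : ℝ, 0 < ρ₀ ∧ ∀ ρ : ℝ, 0 < ρ → ρ < ρ₀ → ∃ c : ℝ, 0 < c ∧ ∀ᶠ N : ℕ in Filter.atTop, ∃ δ : ℝ, 0 < δ ∧ ∀ (m : ℕ) (p : Fin m → ℝ) (Ψ : Fin m → Literature.MathematicalPhysics.QuantumManyBody.BoseGas.TrialState N (Literature.MathematicalPhysics.QuantumManyBody.BoseGas.sideLength ρ N)), (∀ i, 0 ≤ p i) → ∑ i, p i = 1 → (∀ i j, i ≠ j → ∫ X, (starRingEnd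 ℂ) ((Ψ i).ψ X) * (Ψ j).ψ X = 0) → (∀ (m' : ℕ) (p' : Fin m' → ℝ) (Ψ' : Fin m' → Literature.MathematicalPhysics.QuantumManyBody.BoseGas.TrialState N (Literature.MathematicalPhysics.QuantumManyBody.BoseGas.sideLength ρ N)), (∀ j, 0 ≤ p' j) → ∑ j, p' j = 1 → (∀ i j, i ≠ j → ∫ X, (starRingEnd ℂ) ((Ψ' i).ψ X) * (Ψ' j).ψ X = 0) → ∑ i, ENNReal.ofReal (p i) * Literature.MathematicalPhysics.QuantumManyBody.BoseGas.energy v (Ψ i) + ENNReal.ofReal (θ * ρ ^ (2 / 3 : ℝ) * ∑ j, Real.negMulLog (p' j)) ≤ ∑ j, ENNReal.ofReal (p' j) * Literature.MathematicalPhysics.QuantumManyBody.BoseGas.energy v (Ψ' j) + ENNReal.ofReal (θ * ρ ^ (2 / 3 : ℝ) * ∑ i, Real.negMulLog (p i) + δ)) → ENNReal.ofReal (c * N) ≤ ∑ i, ENNReal.ofReal (p i) * Literature.MathematicalPhysics.QuantumManyBody.BoseGas.occupation N ((Literature.MathematicalPhysics.QuantumManyBody.BoseGas.box (Literature.MathematicalPhysics.QuantumManyBody.BoseGas.sideLength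 ρ N)).indicator fun _ => ((Real.sqrt (Literature.MathematicalPhysics.QuantumManyBody.BoseGas.sideLength ρ N ^ 3))⁻¹ : ℂ)) (Ψ i).ψ

/-- item stmt-AtomisticToContinuum-9071 · crux · rank 3 · open · by planner
why it might fail: No Griffiths/Ginibre/FKG structure signs Cov_beta(H, n(phi0)) for interacting bosons (BLU: the U(1) combination is indefinite); as typed it asks exact monotonicity at ALL T > 0 once N is fixed: a low level more phi0-condensed than Psi0 (T ~ gap), or Dirichlet mode-mixing, at infinitely many N.
sources: Ginibre1970, arXiv:1510.03215, KennedyLiebShastry1988, Ueltschi2006, Suto2005, LSSY2005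
[crux] (card P4 = card heating-only-depletes-thermal-bridge's M_T, dilute eventual form, Dirichlet
box, constant mode) for every repulsive finite-range v there is ρ₀ > 0 such that for 0 < ρ < ρ₀ and
all large N (L = (N/ρ)^{1/3}), for all temperatures 0 < T₂ ≤ T₁ and every c: if for some δ > 0 every
δ-near-minimising ensemble of the free energy at T₁ has thermal constant-mode occupation ≥ c, then
for every c′ < c there is δ′ > 0 such that every δ′-near-minimising ensemble at T₂ has occupation ≥
c′ — i.e. T ↦ Tr Γ_T n(φ₀) is non-increasing ("heating only depletes"; d⟨n(φ₀)⟩/dβ = −Cov_β(H,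
n(φ₀)) ≥ 0). Bogoliubov-exact term by term (every thermal quasiparticle removes ≥ 1 particle from
the condensate); ideal gas: Borrmann–Franke recursion; interacting: unproved even on the lattice.
[difficulty: L] -/
@[route_item "route-AtomisticToContinuum-BECClassicalWindow", crux]
def ThermalMonotonicity : Prop :=
  ∀ v : ℝ → ENNReal, Literature.MathematicalPhysics.QuantumManyBody.BoseGas.IsRepulsiveFiniteRange v → ∃ ρ₀ : ℝ, 0 < ρ₀ ∧ ∀ ρ : ℝ, 0 < ρ → ρ < ρ₀ → ∀ᶠ N : ℕ in Filter.atTop, ∀ (T₁ T₂ c : ℝ), 0 < T₂ → T₂ ≤ T₁ → (∃ δ : ℝ, 0 < δ ∧ ∀ (m : ℕ) (p : Fin m → ℝ) (Ψ : Fin m → Literature.MathematicalPhysics.QuantumManyBody.BoseGas.TrialState N (Literature.MathematicalPhysics.QuantumManyBody.BoseGas.sideLength ρ N)), (∀ i, 0 ≤ p i) → ∑ i, p i = 1 → (∀ i j, i ≠ j → ∫ X, (starRingEnd ℂ) ((Ψ i).ψ X) * (Ψ j).ψ X = 0) → (∀ (m' : ℕ) (p' : Fin m' → ℝ) (Ψ'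 : Fin m' → Literature.MathematicalPhysics.QuantumManyBody.BoseGas.TrialState N (Literature.MathematicalPhysics.QuantumManyBody.BoseGas.sideLength ρ N)), (∀ j, 0 ≤ p' j) → ∑ j, p' j = 1 → (∀ i j, i ≠ j → ∫ X, (starRingEnd ℂ) ((Ψ' i).ψ X) * (Ψ' j).ψ X = 0) → ∑ i, ENNReal.ofReal (p i) * Literature.MathematicalPhysics.QuantumManyBody.BoseGas.energy v (Ψ i) + ENNReal.ofReal (T₁ * ∑ j, Real.negMulLog (p' j)) ≤ ∑ j, ENNReal.ofReal (p' j) * Literature.MathematicalPhysics.QuantumManyBody.BoseGas.energy v (Ψ' j) + ENNReal.ofReal (T₁ * ∑ i, Real.negMulLog (p i) + δ)) → ENNReal.ofReal c ≤ ∑ i, ENNReal.ofReal (p i) * Literature.MathematicalPhysics.QuantumManyBody.BoseGas.occupation N ((Literature.MathematicalPhysics.QuantumManyBody.BoseGas.box (Literature.MathematicalPhysics.QuantumManyBody.BoseGas.sideLength ρ N)).indicator fun _ => ((Real.sqrt (Literature.MathematicalPhysics.QuantumManyBody.BoseGas.sideLength ρ N ^ 3))⁻¹ : ℂ)) (Ψ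 i).ψ) → ∀ c' : ℝ, c' < c → ∃ δ' : ℝ, 0 < δ' ∧ ∀ (m : ℕ) (p : Fin m → ℝ) (Ψ : Fin m → Literature.MathematicalPhysics.QuantumManyBody.BoseGas.TrialState N (Literature.MathematicalPhysics.QuantumManyBody.BoseGas.sideLength ρ N)), (∀ i, 0 ≤ p i) → ∑ i, p i = 1 → (∀ i j, i ≠ j → ∫ X, (starRingEnd ℂ) ((Ψ i).ψ X) * (Ψ j).ψ X = 0) → (∀ (m' : ℕ) (p' : Fin m' → ℝ) (Ψ' : Fin m' → Literature.MathematicalPhysics.QuantumManyBody.BoseGas.TrialState N (Literature.MathematicalPhysics.QuantumManyBody.BoseGas.sideLength ρ N)), (∀ j, 0 ≤ p' j) → ∑ j, p' j = 1 → (∀ i j, i ≠ j → ∫ X, (starRingEnd ℂ) ((Ψ' i).ψ X) * (Ψ' j).ψ X = 0) → ∑ i, ENNReal.ofReal (p i) * Literature.MathematicalPhysics.QuantumManyBody.BoseGas.energy v (Ψ i) + ENNReal.ofReal (T₂ * ∑ j, Real.negMulLog (p' j)) ≤ ∑ j, ENNReal.ofReal (p' j) * Literature.MathematicalPhysics.QuantumManyBody.BoseGas.energy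 v (Ψ' j) + ENNReal.ofReal (T₂ * ∑ i, Real.negMulLog (p i) + δ')) → ENNReal.ofReal c' ≤ ∑ i, ENNReal.ofReal (p i) * Literature.MathematicalPhysics.QuantumManyBody.BoseGas.occupation N ((Literature.MathematicalPhysics.QuantumManyBody.BoseGas.box (Literature.MathematicalPhysics.QuantumManyBody.BoseGas.sideLength ρ N)).indicator fun _ => ((Real.sqrt (Literature.MathematicalPhysics.QuantumManyBody.BoseGas.sideLength ρ N ^ 3))⁻¹ : ℂ)) (Ψ i).ψ

/-- item stmt-AtomisticToContinuum-9072 · crux · rank 4 · open · by planner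
why it might fail: Admissible v may be infinite-valued (hard cores, hollow shells): the free configuration set can disconnect; an energy-minimising component other than the dilute one (or not invariant under the cube's isometries) degenerates the Dirichlet ground space; positivity-improving uniqueness needs finite v.
sources: ReedSimonIV1978, Simon1982, BaryshnikovBubenikKahle2013, Kahle2012, LSSY2005
[crux] (shared verbatim with BECPalmLandscape stmt-AtomisticToContinuum-3298; the uniqueness input
of the descent) for every repulsive finite-range v there is ρ₀ > 0 such that for 0 < ρ < ρ₀ and all
large N, for every η > 0 there is δ > 0 with: any two δ-near-minimisers Ψ, Φ of the Dirichlet energy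
in the box of side (N/ρ)^{1/3} satisfy ∫|Ψ − cΦ|² ≤ η for some unit complex c (E₀ < ∞, compact
resolvent, unique positive ground state and spectral gap at fixed N). [difficulty: M] -/
@[route_item "route-AtomisticToContinuum-BECClassicalWindow", crux]
def GroundStateRigidity : Prop :=
  ∀ v : ℝ → ENNReal, Literature.MathematicalPhysics.QuantumManyBody.BoseGas.IsRepulsiveFiniteRange v → ∃ ρ₀ : ℝ, 0 < ρ₀ ∧ ∀ ρ : ℝ, 0 < ρ → ρ < ρ₀ → ∀ᶠ N : ℕ in Filter.atTop, ∀ η : ℝ, 0 < η → ∃ δ : ENNReal, 0 < δ ∧ ∀ Ψ Φ : Literature.MathematicalPhysics.QuantumManyBody.BoseGas.TrialState N (Literature.MathematicalPhysics.QuantumManyBody.BoseGas.sideLength ρ N), Literature.MathematicalPhysics.QuantumManyBody.BoseGas.energy v Ψ ≤ Literature.MathematicalPhysics.QuantumManyBody.BoseGas.groundStateEnergy v N (Literature.MathematicalPhysics.QuantumManyBody.BoseGas.sideLength ρ N) + δ → Literature.MathematicalPhysics.QuantumManyBody.BoseGas.energy v Φ ≤ Literature.MathematicalPhysics.QuantumManyBody.BoseGas.groundStateEnergy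 v N (Literature.MathematicalPhysics.QuantumManyBody.BoseGas.sideLength ρ N) + δ → ∃ c : ℂ, ‖c‖ = 1 ∧ ∫⁻ X, (‖Ψ.ψ X - c * Φ.ψ X‖₊ : ENNReal) ^ 2 ≤ ENNReal.ofReal η

-- item stmt-AtomisticToContinuum-9477 · support · rank 5 · open · by planner — informal only, no Lean statement yet:
--   [crux] ClassicalWindowReduction (card thermal-window-classical-infrared P1+P2; engine B, child of
--   ThermalWindowZeroMode in the two-layer plan; to be typed once definitions ThermalExpectation and
--   LatticePhi4Gibbs land). For T = θρ^{2/3} (θ below the free critical constant 4π/ζ(3/2)^{2/3} =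
--   6.625) and ρa³ small, the canonical Gibbs state of the Dirichlet N-body Hamiltonian in the box of
--   side (N/ρ)^{1/3}, coarse-grained to block averages of the boson field over cells of side ℓ with λ_T
--   = √(4π/T) ≤ ℓ ≤ ξ = (8πρa)^{-1/2}, is a classical Gibbs measure exp(−S_cl − R)Πdφ with S_cl the
--   nearest-neighbou

/-- item stmt-AtomisticToContinuum-9073 · support · rank 9 · closed · proved by Summit.AtomisticToContinuum.BoseEinsteinCondensation.Theorems.thermalGroundStateLimit_proof @ 7b950d9f5d5b (prover) · by planner
sources: ReedSimonIV1978, LSSY2005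
[support] (card P4's β → ∞ step, fixed N and L > 0) if for some c and all temperatures 0 < T ≤ T₀
there is δ(T) > 0 such that every δ-near-minimising ensemble of the free energy at T has thermal
constant-mode occupation ≥ c, then for every c′ < c and every energy slack δ′ > 0 there is a
Dirichlet trial state Ψ with energy ≤ E₀(N,L) + δ′ and ⟨φ₀,γ_Ψφ₀⟩ ≥ c′. Proof: Z(β) = Tr_sym e^{−βH}
< ∞ (compact resolvent, Weyl), the finite-ensemble infimum of F is −T log Z (Gibbs variational
principle on the C¹ form core), Pinsker gives Tr Γ_T n(φ₀) ≥ c, Γ_T → Π₀/g in trace norm as T → 0,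
so some ground state has n(φ₀) ≥ c; approximate it in form norm by C¹ Dirichlet trial states
(occupation is L²-continuous). Known analysis, heavy in Lean (no operators yet: the whole argument
must be run on quadratic forms / ensembles). [difficulty: L] -/
@[route_item "route-AtomisticToContinuum-BECClassicalWindow", crux]
def ThermalGroundStateLimit : Prop :=
  ∀ v : ℝ → ENNReal, Literature.MathematicalPhysics.QuantumManyBody.BoseGas.IsRepulsiveFiniteRange v → ∀ (N : ℕ) (L T₀ c : ℝ), 0 < L → 0 < T₀ → (∀ T : ℝ, 0 < T → T ≤ T₀ → ∃ δ : ℝ, 0 < δ ∧ ∀ (m : ℕ) (p : Fin m → ℝ) (Ψ : Fin m → Literature.MathematicalPhysics.QuantumManyBody.BoseGas.TrialState N L), (∀ i, 0 ≤ p i) → ∑ i, p i = 1 → (∀ i j, i ≠ j → ∫ X, (starRingEnd ℂ) ((Ψ i).ψ X) * (Ψ j).ψ X = 0) → (∀ (m' : ℕ) (p' : Fin m' → ℝ) (Ψ' : Fin m' → Literature.MathematicalPhysics.QuantumManyBody.BoseGas.TrialState N L), (∀ j, 0 ≤ p' j) → ∑ j, p' j = 1 → (∀ i j, i ≠ j →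 ∫ X, (starRingEnd ℂ) ((Ψ' i).ψ X) * (Ψ' j).ψ X = 0) → ∑ i, ENNReal.ofReal (p i) * Literature.MathematicalPhysics.QuantumManyBody.BoseGas.energy v (Ψ i) + ENNReal.ofReal (T * ∑ j, Real.negMulLog (p' j)) ≤ ∑ j, ENNReal.ofReal (p' j) * Literature.MathematicalPhysics.QuantumManyBody.BoseGas.energy v (Ψ' j) + ENNReal.ofReal (T * ∑ i, Real.negMulLog (p i) + δ)) → ENNReal.ofReal c ≤ ∑ i, ENNReal.ofReal (p i) * Literature.MathematicalPhysics.QuantumManyBody.BoseGas.occupation N ((Literature.MathematicalPhysics.QuantumManyBody.BoseGas.box L).indicator fun _ => ((Real.sqrt (L ^ 3))⁻¹ : ℂ)) (Ψ i).ψ) → ∀ c' : ℝ, c' < c → ∀ δ' : ENNReal, 0 < δ' → ∃ Ψ : Literature.MathematicalPhysics.QuantumManyBody.BoseGas.TrialState N L, Literature.MathematicalPhysics.QuantumManyBody.BoseGas.energy v Ψ ≤ Literature.MathematicalPhysics.QuantumManyBody.BoseGas.groundStateEnergy v N L + δ' ∧ ENNReal.ofReal c' ≤ Literature.MathematicalPhysics.QuantumManyBody.BoseGas.occupation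 N ((Literature.MathematicalPhysics.QuantumManyBody.BoseGas.box L).indicator fun _ => ((Real.sqrt (L ^ 3))⁻¹ : ℂ)) Ψ.ψ

/-- item stmt-AtomisticToContinuum-9074 · support · rank 9 · closed · proved by Summit.AtomisticToContinuum.BoseEinsteinCondensation.Theorems.occupationStability_proof @ 4a4e6659c153 (prover) · by planner
sources: LSSY2005
[support] (shared verbatim with BECPalmLandscape stmt-AtomisticToContinuum-3300) for a normalised
measurable mode u, trial states Ψ, Φ ∈ TrialState (n+1) L and |c| = 1: occ(u,Ψ)^{1/2} ≤
occ(u,Φ)^{1/2} + (n+1)^{1/2}·‖Ψ − cΦ‖₂ (Minkowski in L²(dY); occ(cΦ) = occ(Φ)). [difficulty: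
provable-now] -/
@[route_item "route-AtomisticToContinuum-BECClassicalWindow", crux]
def OccupationStability : Prop :=
  ∀ (n : ℕ) (L : ℝ) (u : Literature.MathematicalPhysics.QuantumManyBody.BoseGas.Space → ℂ), MeasureTheory.AEStronglyMeasurable u MeasureTheory.volume → ∫⁻ x, (‖u x‖₊ : ENNReal) ^ 2 = 1 → ∀ (Ψ Φ : Literature.MathematicalPhysics.QuantumManyBody.BoseGas.TrialState (n + 1) L) (c : ℂ), ‖c‖ = 1 → Literature.MathematicalPhysics.QuantumManyBody.BoseGas.occupation (n + 1) u Ψ.ψ ^ (1 / 2 : ℝ) ≤ Literature.MathematicalPhysics.QuantumManyBody.BoseGas.occupation (n + 1) u Φ.ψ ^ (1 / 2 : ℝ) + ((n + 1 : ℕ) : ENNReal) ^ (1 / 2 : ℝ) * (∫⁻ X, (‖Ψ.ψ X - c * Φ.ψ X‖₊ : ENNReal) ^ 2) ^ (1 / 2 : ℝ)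

/-- `OccupationStability` holds: proved by `Summit.AtomisticToContinuum.BoseEinsteinCondensation.Theorems.occupationStability_proof` @ 4a4e6659c153. -/
theorem OccupationStability_holds : OccupationStability := _root_.Summit.AtomisticToContinuum.BoseEinsteinCondensation.Theorems.occupationStability_proof

/-- item stmt-AtomisticToContinuum-9075 · support · rank 9 · closed · proved by Summit.AtomisticToContinuum.BoseEinsteinCondensation.Theorems.thermalDescent_proof @ 0a8001820c7f (prover) · by planner
sources: LSSY2005
[support] (glue, provable now; the analytic bookkeeping of the assembly isolated as one lemma so
that the deciding theorem is one line) ThermalWindowZeroMode → ThermalMonotonicity →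
GroundStateRigidity → [ThermalGroundStateLimit, inlined] → [OccupationStability, inlined] → X_B1
(stmt-AtomisticToContinuum-0686 body verbatim: every δ-near-minimiser of the Dirichlet energy has
⟨φ₀,γ_Ψφ₀⟩ ≥ c′N). Proof = the paragraph under ## Assembly (constants c/2, c/4, η = c/16, c′ = c/16;
intersect the eventual-in-N sets; ENNReal.ofReal / rpow ½ arithmetic). [difficulty: provable-now] -/
@[route_item "route-AtomisticToContinuum-BECClassicalWindow", crux]
def ThermalDescent : Prop :=
  ThermalWindowZeroMode → ThermalMonotonicity → GroundStateRigidity → (∀ v : ℝ → ENNReal, Literature.MathematicalPhysics.QuantumManyBody.BoseGas.IsRepulsiveFiniteRange v → ∀ (N : ℕ) (L T₀ c : ℝ), 0 < L → 0 < T₀ → (∀ T : ℝ, 0 < T → T ≤ T₀ → ∃ δ : ℝ, 0 < δ ∧ ∀ (m : ℕ) (p : Fin m → ℝ) (Ψ : Fin m → Literature.MathematicalPhysics.QuantumManyBody.BoseGas.TrialState N L), (∀ i, 0 ≤ p i) → ∑ i, p i = 1 → (∀ i j, i ≠ j → ∫ X, (starRingEnd ℂ) ((Ψ i).ψ X) *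 (Ψ j).ψ X = 0) → (∀ (m' : ℕ) (p' : Fin m' → ℝ) (Ψ' : Fin m' → Literature.MathematicalPhysics.QuantumManyBody.BoseGas.TrialState N L), (∀ j, 0 ≤ p' j) → ∑ j, p' j = 1 → (∀ i j, i ≠ j → ∫ X, (starRingEnd ℂ) ((Ψ' i).ψ X) * (Ψ' j).ψ X = 0) → ∑ i, ENNReal.ofReal (p i) * Literature.MathematicalPhysics.QuantumManyBody.BoseGas.energy v (Ψ i) + ENNReal.ofReal (T * ∑ j, Real.negMulLog (p' j)) ≤ ∑ j, ENNReal.ofReal (p' j) * Literature.MathematicalPhysics.QuantumManyBody.BoseGas.energy v (Ψ' j) + ENNReal.ofReal (T * ∑ i, Real.negMulLog (p i) + δ)) → ENNReal.ofReal c ≤ ∑ i, ENNReal.ofReal (p i) * Literature.MathematicalPhysics.QuantumManyBody.BoseGas.occupation N ((Literature.MathematicalPhysics.QuantumManyBody.BoseGas.box L).indicator fun _ => ((Real.sqrt (L ^ 3))⁻¹ : ℂ)) (Ψ i).ψ) → ∀ c' : ℝ, c' < c → ∀ δ' : ENNReal, 0 < δ' → ∃ Ψ : Literature.MathematicalPhysics.QuantumManyBody.BoseGas.TrialState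 N L, Literature.MathematicalPhysics.QuantumManyBody.BoseGas.energy v Ψ ≤ Literature.MathematicalPhysics.QuantumManyBody.BoseGas.groundStateEnergy v N L + δ' ∧ ENNReal.ofReal c' ≤ Literature.MathematicalPhysics.QuantumManyBody.BoseGas.occupation N ((Literature.MathematicalPhysics.QuantumManyBody.BoseGas.box L).indicator fun _ => ((Real.sqrt (L ^ 3))⁻¹ : ℂ)) Ψ.ψ) → (∀ (n : ℕ) (L : ℝ) (u : Literature.MathematicalPhysics.QuantumManyBody.BoseGas.Space → ℂ), MeasureTheory.AEStronglyMeasurable u MeasureTheory.volume → ∫⁻ x, (‖u x‖₊ : ENNReal) ^ 2 = 1 → ∀ (Ψ Φ : Literature.MathematicalPhysics.QuantumManyBody.BoseGas.TrialState (n + 1) L) (c : ℂ), ‖c‖ = 1 → Literature.MathematicalPhysics.QuantumManyBody.BoseGas.occupation (n + 1) u Ψ.ψ ^ (1 / 2 : ℝ) ≤ Literature.MathematicalPhysics.QuantumManyBody.BoseGas.occupation (n + 1) u Φ.ψ ^ (1 / 2 : ℝ) + ((n + 1 : ℕ) : ENNReal) ^ (1 / 2 : ℝ) * (∫⁻ X,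 (‖Ψ.ψ X - c * Φ.ψ X‖₊ : ENNReal) ^ 2) ^ (1 / 2 : ℝ)) → ∀ v : ℝ → ENNReal, Literature.MathematicalPhysics.QuantumManyBody.BoseGas.IsRepulsiveFiniteRange v → ∃ ρ₀ : ℝ, 0 < ρ₀ ∧ ∀ ρ : ℝ, 0 < ρ → ρ < ρ₀ → ∃ c : ℝ, 0 < c ∧ ∀ᶠ N : ℕ in Filter.atTop, ∃ δ : ENNReal, 0 < δ ∧ ∀ Ψ : Literature.MathematicalPhysics.QuantumManyBody.BoseGas.TrialState N (Literature.MathematicalPhysics.QuantumManyBody.BoseGas.sideLength ρ N), Literature.MathematicalPhysics.QuantumManyBody.BoseGas.energy v Ψ ≤ Literature.MathematicalPhysics.QuantumManyBody.BoseGas.groundStateEnergy v N (Literature.MathematicalPhysics.QuantumManyBody.BoseGas.sideLength ρ N) + δ → ENNReal.ofReal (c * N) ≤ Literature.MathematicalPhysics.QuantumManyBody.BoseGas.occupation N ((Literature.MathematicalPhysics.QuantumManyBody.BoseGas.box (Literature.MathematicalPhysics.QuantumManyBody.BoseGas.sideLength ρ N)).indicator fun _ => ((Real.sqrt (Literature.MathematicalPhysics.QuantumManyBody.BoseGas.sideLength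 ρ N ^ 3))⁻¹ : ℂ)) Ψ.ψ

/-- item stmt-AtomisticToContinuum-9076 · assembly · rank 1 · closed · proved by Summit.AtomisticToContinuum.BoseEinsteinCondensation.Theorems.becClassicalWindow_assembly_proof (prover) · by planner
sources: LSSY2005, LiebSeiringerSolovejYngvason2005
[assembly] ThermalWindowZeroMode → ThermalMonotonicity → GroundStateRigidity →
ThermalGroundStateLimit → OccupationStability → ThermalDescent → BoseEinsteinCondensation (the
audited sub-problem abbrev _root_.BoseEinsteinCondensation of
Summits/AtomisticToContinuum/BoseEinsteinCondensation/Statement.lean, by name; = the type of the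
deciding theorem `closes`). -/
@[route_item "route-AtomisticToContinuum-BECClassicalWindow"]
def Assembly : Prop :=
  ThermalWindowZeroMode → ThermalMonotonicity → GroundStateRigidity → ThermalGroundStateLimit → OccupationStability → ThermalDescent → _root_.BoseEinsteinCondensation

/-! D-0027 §2.1 — DECIDING THEOREM (planner-authored via `route open/edit --closes-file`; by planner-plancard-AtomisticToContinuum-BoseEin-3c98a4b7-0 2026-08-15T13:47:59Z):
its hypotheses are this route's items and its conclusion the sub-problem Statement (glue_lint), and it elaborates with this file. -/

/-- DECIDING THEOREM (D-0027 §2.1): the route's items imply the audited sub-problem Statement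
`_root_.BoseEinsteinCondensation` — the glue support `ThermalDescent` turns the three thermal items,
rigidity and stability into X_B1 (stmt-AtomisticToContinuum-0686), and X_B1 → BEC is the proved
`AtomisticToContinuum.BECInfraredBound.bec_of_zeroMode`. -/
@[closes "route-AtomisticToContinuum-BECClassicalWindow"] theorem closes : ThermalWindowZeroMode → ThermalMonotonicity → GroundStateRigidity → ThermalGroundStateLimit → OccupationStability → ThermalDescent → _root_.BoseEinsteinCondensation :=
  fun h₁ h₂ h₃ h₄ h₅ h₆ => _root_.AtomisticToContinuum.BECInfraredBound.bec_of_zeroMode (h₆ h₁ h₂ h₃ h₄ h₅)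

end Summit.AtomisticToContinuum.BoseEinsteinCondensation.Theses.BECClassicalWindow
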